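import Summits.AtomisticToContinuum.Crystallization.Theorems.ChartedZeroExcessLayeredLatticeLiouvilleZZZI

/-!
# (B′.7d) ZZZJ — BARLOW GLUING AT THE SHADOW DIALS `(1/15, 8999/10000, 103/100)`, part 2: walks, cubic growth, `IsCharted` (6 theorems, 0 def)

Lineage `stmt-AtomisticToContinuum-26636` (route ChartedPlanarOrder), lens-2 g82; piece (CC) `PlacedCrystalChartP` of ZZZG.  PORT of lens-3's
part III §2–§4 (`…ChartedPlanarOrderBarlowGluing`: `step_far`, `exists_walk`, `connected`, `cubicGrowth`, `growth`, `isCharted_μS`) with the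
two-step radius `27/20` replaced by `134/100` (ZZZI `loc_walk`): a greedy step still gains `1/12` from distance `≥ 134/100`
(`r² − (278/250) r + 784/625 ≤ (r − 1/12)²` iff `r ≥ 1.3196`), and `(n/15)³ ≤ #Ball_n` still holds for `n ≥ 12`
(`n/15 ≤ (134/100 + (n − 2)/12 − 6/5)/(6/5)` iff `n ≥ 8`).  The dial-free lemmas `finite_inter_closedBall` / `cube_le_ncard` are lens-3's, cited
by name; the frame `ChartedPlanarOrderBarlowGluingFrame.isCharted_μS_of_chartBundle` is dial-free.

* ★ `isCharted_μS` — **an all-`(1/15, 8999/10000, 103/100)`-good uniformly discrete set containing `0` is Barlow-charted** (`IsCharted (μS Y)`).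

No new idea (credit: lens-3 `ChartedPlanarOrderBarlowGluing`; [HalesDSP2012, §1.3]; [ConwaySloane1999, Ch. 4 §6.3]); 0 sorry; no def, no
instance, no notation (the `local notation "E3"` line is lens-3's, file-local).
-/

noncomputable section

namespace Summit.AtomisticToContinuum.Crystallization.Theorems.ChartedZeroExcessLayeredLatticeLiouville.ShadowGluing

open Literature.Geometry.DiscreteGeometry
open Literature.MathematicalPhysics.StatisticalMechanics (UniformlyDiscrete)
open Summit.AtomisticToContinuum.Crystallization.Theorems.PalmUnimodularRigidityShellsToBarlowChart
open Summit.AtomisticToContinuum.Crystallization.Theorems.ChartedPlanarOrderRigidityDoor (IsCharted)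
open Summit.AtomisticToContinuum.Crystallization.Theorems.ChartedPlanarOrderDensityDichotomy (μS)
open Summit.AtomisticToContinuum.Crystallization.Theorems.ChartedPlanarOrderBarlowGluingFrame (isCharted_μS_of_chartBundle)
open Summit.AtomisticToContinuum.Crystallization.Theorems.ChartedPlanarOrderBarlowGluing (finite_inter_closedBall cube_le_ncard)
open MeasureTheory Metric
open scoped ENNReal NNReal

local notation "E3" => EuclideanSpace ℝ (Fin 3)

/-! ## §2 Greedy walks: connectivity -/

section Growth

variable {S : Set E3}

/-- At distance `≥ 134/100` from the target a greedy step gains `1/12`. [folklore] -/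
theorem step_far {r : ℝ} (hr : 134 / 100 ≤ r) : r ^ 2 - 278 / 250 * r + 784 / 625 ≤ (r - 1 / 12) ^ 2 := by
  nlinarith

/-- **Greedy walks.** If targets within `27/20` are two steps away and every site has a bonded neighbour
in every direction (cosine `≥ 139/250`), then every `x ∈ S` with `dist (x, z) ≤ 134/100 + m/12`, `z ∈ S`,
is joined to `z` by a walk of length `≤ m + 2`. [folklore] -/
theorem exists_walk
    (hloc : ∀ x ∈ S, ∀ z ∈ S, dist x z ≤ 134 / 100 → ∃ w : (windowGraph S).Walk x z, w.length ≤ 2)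
    (hdir : ∀ x ∈ S, ∀ d : E3, ∃ y ∈ S, y ≠ x ∧ dist x y ≤ 28 / 25 ∧ 139 / 250 * ‖d‖ ≤ inner ℝ (y - x) d)
    {z : E3} (hz : z ∈ S) :
    ∀ m : ℕ, ∀ x ∈ S, dist x z ≤ 134 / 100 + (m : ℝ) / 12 →
      ∃ w : (windowGraph S).Walk x z, w.length ≤ m + 2 := by
  intro m
  induction m with
  | zero =>
    intro x hx hd
    obtain ⟨w, hw⟩ := hloc x hx z hz (by simpa using hd)
    exact ⟨w, by omega⟩
  | succ m ih =>
    intro x hx hd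
    by_cases hle : dist x z ≤ 134 / 100 + (m : ℝ) / 12
    · obtain ⟨w, hw⟩ := ih x hx hle
      exact ⟨w, by omega⟩
    have hlt := not_le.1 hle
    obtain ⟨y, hy, hadj, hest⟩ := CleanHull.clean_exists_step hdir hx z
    have h32 : 134 / 100 ≤ dist x z := by
      have : (0 : ℝ) ≤ (m : ℝ) / 12 := by positivity
      linarith
    have h2 : dist y z ^ 2 ≤ (dist x z - 1 / 12) ^ 2 := hest.trans (step_far h32)
    have hyz : dist y z ≤ dist x z - 1 / 12 := (abs_le_of_sq_le_sq' h2 (by linarith)).2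
    have hyz' : dist y z ≤ 134 / 100 + (m : ℝ) / 12 := by
      push_cast at hd
      linarith
    obtain ⟨w, hw⟩ := ih y hy hyz'
    exact ⟨SimpleGraph.Walk.cons hadj w, by rw [SimpleGraph.Walk.length_cons]; omega⟩

/-- **The window graph is connected.** [folklore] -/
theorem connected
    (hloc : ∀ x ∈ S, ∀ z ∈ S, dist x z ≤ 134 / 100 → ∃ w : (windowGraph S).Walk x z, w.length ≤ 2)
    (hdir : ∀ x ∈ S, ∀ d : E3, ∃ y ∈ S, y ≠ x ∧ dist x y ≤ 28 / 25 ∧ 139 / 250 * ‖d‖ ≤ inner ℝ (y - x) d) :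
    ∀ x ∈ S, ∀ y ∈ S, Nonempty ((windowGraph S).Walk x y) := by
  intro x hx y hy
  have hm : dist x y ≤ 134 / 100 + ((⌈12 * dist x y⌉₊ : ℕ) : ℝ) / 12 := by
    have h1 : 12 * dist x y ≤ ((⌈12 * dist x y⌉₊ : ℕ) : ℝ) := Nat.le_ceil _
    linarith [dist_nonneg (x := x) (y := y)]
  obtain ⟨w, -⟩ := exists_walk hloc hdir hy ⌈12 * dist x y⌉₊ x hx hm
  exact ⟨w⟩


/-! ## §3 Cubic growth (lens-3 `finite_inter_closedBall` / `cube_le_ncard` cited by name) -/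

/-- **Cubic growth of the window graph**: the ball of radius `n ≥ 12` about `x ∈ S` in the window graph
has at least `(n/15)³` points. [folklore] -/
theorem cubicGrowth (hud : UniformlyDiscrete S)
    (hloc : ∀ x ∈ S, ∀ z ∈ S, dist x z ≤ 134 / 100 → ∃ w : (windowGraph S).Walk x z, w.length ≤ 2)
    (hdir : ∀ x ∈ S, ∀ d : E3, ∃ y ∈ S, y ≠ x ∧ dist x y ≤ 28 / 25 ∧ 139 / 250 * ‖d‖ ≤ inner ℝ (y - x) d)
    {x : E3} (hx : x ∈ S) {n : ℕ} (hn : 12 ≤ n) :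
    ((n : ℝ) / 15) ^ 3 ≤ (Set.ncard (windowBall S x n) : ℝ) := by
  have hsub : S ∩ closedBall x (134 / 100 + ((n - 2 : ℕ) : ℝ) / 12) ⊆ windowBall S x n := by
    rintro y ⟨hy, hyR⟩
    rw [mem_closedBall, dist_comm] at hyR
    obtain ⟨w, hw⟩ := exists_walk hloc hdir hy (n - 2) x hx hyR
    exact ⟨w, by omega⟩
  have hWfin : (windowBall S x n).Finite := by
    refine (finite_inter_closedBall hud x (28 / 25 * n)).subset ?_
    rintro y ⟨w, hw⟩
    obtain ⟨hyS, hd⟩ := walk_mem_and_dist w hx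
    refine ⟨hyS, mem_closedBall.2 ?_⟩
    rw [dist_comm]
    have : (w.length : ℝ) ≤ n := by exact_mod_cast hw
    linarith
  have hR : (6 : ℝ) / 5 ≤ 134 / 100 + ((n - 2 : ℕ) : ℝ) / 12 := by
    have : (0 : ℝ) ≤ ((n - 2 : ℕ) : ℝ) / 12 := by positivity
    linarith
  have hcount := cube_le_ncard hud hdir hx hR
  have hmono : (Set.ncard (S ∩ closedBall x (134 / 100 + ((n - 2 : ℕ) : ℝ) / 12)) : ℝ) ≤
      Set.ncard (windowBall S x n) := by
    exact_mod_cast Set.ncard_le_ncard hsub hWfin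
  refine le_trans ?_ (hcount.trans hmono)
  have hn0 : (12 : ℝ) ≤ n := by exact_mod_cast hn
  rw [Nat.cast_sub (by omega : 2 ≤ n)]
  push_cast
  have h1 : (n : ℝ) / 15 ≤ (134 / 100 + ((n : ℝ) - 2) / 12 - 6 / 5) / (6 / 5) := by linarith
  exact pow_le_pow_left₀ (by positivity) h1 3

/-- **Eventual cubic growth with an existential constant** (the hypothesis `hgrowth` of
`PalmGoodLaw.FunnelChart.barlowChart_of_transportSystem`). [folklore] -/
theorem growth (hud : UniformlyDiscrete S)
    (hloc : ∀ x ∈ S, ∀ z ∈ S, dist x z ≤ 134 / 100 → ∃ w : (windowGraph S).Walk x z, w.length ≤ 2)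
    (hdir : ∀ x ∈ S, ∀ d : E3, ∃ y ∈ S, y ≠ x ∧ dist x y ≤ 28 / 25 ∧ 139 / 250 * ‖d‖ ≤ inner ℝ (y - x) d) :
    ∀ x ∈ S, ∃ C : ℝ, 0 < C ∧ ∃ n₀ : ℕ, ∀ n : ℕ, n₀ ≤ n →
      C * (n : ℝ) ^ 3 ≤ (Set.ncard (windowBall S x n) : ℝ) := by
  intro x hx
  refine ⟨1 / 3375, by norm_num, 12, fun n hn => ?_⟩
  have e : (1 : ℝ) / 3375 * (n : ℝ) ^ 3 = ((n : ℝ) / 15) ^ 3 := by ring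
  rw [e]
  exact cubicGrowth hud hloc hdir hx hn

end Growth

/-! ## §4 Assembly -/

/-- **An all-good uniformly discrete set containing `0` is Barlow-charted**: its `(0, 28/25]`-bond graph
is isomorphic to the contact graph of a Barlow stacking `barlowStacking 1 √(2/3) s`, `s` a Hägg word.
Charts + transfer + connectivity give a `TransportSystem` (`Clean.transportSystem_of_connected`); cubic
growth feeds the 9227 growth descent (`PalmGoodLaw.FunnelChart.barlowChart_of_transportSystem`).
[cite: HalesDSP2012, §1.3; ConwaySloane1999, Ch. 4 §6.3] -/
theorem isCharted_μS {Y : Set E3} (h0 : (0 : E3) ∈ Y) (hud : UniformlyDiscrete Y)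
    (hY : ∀ q ∈ Y, IsTwoShellGoodSet (1 / 15) (8999 / 10000) (103 / 100) Y q) : IsCharted (μS Y) := by
  obtain ⟨Pc, nb, hch, hdir⟩ := charts hY
  have hloc := loc_walk hY
  exact isCharted_μS_of_chartBundle h0 hch (connected hloc hdir) (growth hud hloc hdir)

end Summit.AtomisticToContinuum.Crystallization.Theorems.ChartedZeroExcessLayeredLatticeLiouville.ShadowGluing

end
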